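import Mathlib
import Summits.CriticalPhenomena.CardyFormulaZ2.Theorems.CardyFlipRussoSquareFromVoronoiHubDilutionDefs
import Summits.CriticalPhenomena.CardyFormulaZ2.Theorems.CardyFlipRussoSquareFromVoronoiHubDilutionLatticeEndPart1
import Summits.CriticalPhenomena.CardyFormulaZ2.Theorems.CardyFlipRussoSquareFromVoronoiHubFaithfulDefs
import Summits.CriticalPhenomena.CardyFormulaZ2.Theorems.CardyFlipRussoSquareFromVoronoiHubFaithfulPart7
import Summits.CriticalPhenomena.CardyFormulaZ2.Theorems.CardyFlipRussoSquareFromVoronoiHubPerturbedRectangles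
import Summits.CriticalPhenomena.CardyFormulaZ2.Theorems.CardyFlipRussoSquareFromVoronoiHubChessboardEndpointPart1
import Literature.Probability.Percolation.VoronoiCrossing
import Literature.Probability.Percolation.SitePaths
import Literature.Analysis.FunctionSpaces.PoissonPointProcess
import Literature.Analysis.FunctionSpaces.PoissonPointProcessExistence
import HarnessLib

/-!
# Stub `stub_latticeEnd_of` of line `poisson-dilution-leg`, crux `SquareFromVoronoiHub`:
# the lattice end — Cardy for the `t = 0` leg gives Cardy for the crude site crossing of `G_s`

Crux `Summit.CriticalPhenomena.CardyFormulaZ2.Theses.CardyFlipRusso.SquareFromVoronoiHub`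
(stmt-CriticalPhenomena-6434, route `CardyFlipRusso`; lead c5 skeleton
`Cruxes/SquareFromVoronoiHub/Lines/poisson_dilution_leg.lean`), line `poisson-dilution-leg`,
registered stub `stub_latticeEnd_of` (L, the lattice-end ASSEMBLY), proved here under its registered
name from the five lattice pieces it consumes as hypotheses — the `t = 0` law reduction
(`stub_latticeLaw`: `legProb 0 PB PW R δ = latProb R δ`), the cells-and-hubs dictionary
(`stub_latticeDictionary`: `legBlackRegion (toLeg θ) = latBlack θ` on good configurations), the
square-chain lemma (`stub_latticeChain`), the law of the `G_s` coins (`stub_gsConfigLaw`: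
`latMeasure.map gsConfig = sitePercolation _ half`) and the local no-touch lemma
(`stub_latticeNoTouch`) — together with Part 1 (`…DilutionLatticeEndPart1`: flip invariance
`latMeasure_real_preimage_latFlip`, null bad event `latMeasure_bad`, lower inclusion
`mem_crudeCrossing_of_latBlack_path`, upper exclusion `false_of_crudeCrossing_of_whitePath`), K1's
perturbed conformal rectangles (`stub_perturbedRectangles`: `lowerMargins` / `upperMargins`, Cardy
values within `θ`) and the measurability of the crude event (`measurableSet_crudeCrossing`).

* `latSandwich_at` — **the sandwich at a fixed small mesh** `δ`: for margins `r > δ`, `r ≥ 2δ` of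
  the perturbed rectangles `R₁`, `R₂` of `R`,
  `latProb R₁ δ ≤ siteCrossingProb R δ ≤ 1 − latProb R₂ δ`.
  On the good event (both colours occur among the lattice coins; its complement is NULL) a black
  continuum crossing of `R₁` in the lattice-end black region gives the crude crossing of `R` for
  `gsConfig θ` (lower inclusion), and the crude crossing excludes a white continuum crossing of `R₂`
  (upper exclusion); the bookkeeping is done against the MEASURABLE crude event
  (`measureReal_inter_add_sdiff`, `probReal_compl_eq_one_sub`), whose probability is
  `siteCrossingProb R δ` by the `G_s` law (`Measure.map_apply`), the white crossing probability
  being `latProb R₂ δ` by flip invariance.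
* `latticeEnd` / `stub_latticeEnd_of` — **the endpoint**: a Poisson law of intensity `0` exists
  (Kingman), so the Cardy hypothesis for the `t = 0` leg and the law reduction give
  `latProb R' δ → F(η_{R'})` for every `R'`; given `ε > 0`, K1's perturbed rectangles at `θ = ε/4`,
  eventually in `δ → 0⁺` the sandwich holds and `latProb R₁ δ`, `latProb R₂ δ` are within `ε/4` of
  `F(η₁)`, `F(η₂)`, themselves within `ε/4` of `F(η)`, `1 − F(η)`: hence
  `|siteCrossingProb R δ − F(η)| < ε` eventually.

Sources: Bollobás–Riordan, *Percolation* (2006), Ch. 7 Lemma 14 with (19) (sandwich by perturbed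
marked domains), Ch. 8 §8.1–8.3 (two-coloured Voronoi tessellations, duality, lattice
approximations); Kingman, *Poisson Processes* (1993), §2.5.
-/

noncomputable section

open scoped Topology
open MeasureTheory Metric Set Filter
open Literature.Analysis.FunctionSpaces (PointConfig IsPoissonPointProcess
  existsUnique_isPoissonPointProcess_holds)
open Literature.Probability.Percolation (SiteConfig sitePercolation half blackRegion voronoiCrossing)
open Literature.Probability.RandomPlanarGeometry (ConformalRectangle cardyFunction crossRatio)
open Summit.CriticalPhenomena.CardyFormulaZ2.Cruxes.SquareFromVoronoiHub.VoronoiBlocks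
  (zGs Gs crudeCrossing siteCrossingProb voronoiCrossingProb squareFromVoronoiHub_iff)

namespace Summit.CriticalPhenomena.CardyFormulaZ2.Cruxes.SquareFromVoronoiHub.PoissonDilutionLeg

open Literature.Probability.Percolation (PathIn)
open Summit.CriticalPhenomena.CardyFormulaZ2.Cruxes.SquareFromVoronoiHub.VoronoiBlocks.Faithful
  (lowerMargins upperMargins stub_perturbedRectangles eventually_lt_infDist_arc_two)
open Summit.CriticalPhenomena.CardyFormulaZ2.Cruxes.SquareFromVoronoiHub.PoissonisedChessboard
  (measurableSet_crudeCrossing)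

/-! ### Path data of a good configuration in the lattice crossing event -/

/-- **The lattice crossing event as a path**, for a GOOD configuration (both colours occur among
the lattice coins): by the dictionary `legBlackRegion (toLeg θ) = latBlack θ`, membership of `θ`
in `latCrossing R δ` yields a path from a point of `R.arc 0` to a point of `R.arc 2` all of whose
points lie in `closure Ω` and, divided by `δ`, in `latBlack θ` (`JoinedIn.somePath`). [folklore] -/
theorem exists_path_of_mem_latCrossing
    (hdict : ∀ θ : LatConfig, θ.1.Nonempty → θ.1ᶜ.Nonempty → legBlackRegion (toLeg θ) = latBlack θ)
    {R : ConformalRectangle} {δ : ℝ} {θ : LatConfig} (h : θ ∈ latCrossing R δ)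
    (h₁ : θ.1.Nonempty) (h₂ : θ.1ᶜ.Nonempty) :
    ∃ (x y : ℂ) (γ : Path x y), x ∈ R.arc 0 ∧ y ∈ R.arc 2 ∧
      ∀ t, γ t ∈ closure R.carrier ∧ γ t / (δ : ℂ) ∈ latBlack θ := by
  obtain ⟨x, hx, y, hy, hJ⟩ := h
  rw [hdict θ h₁ h₂] at hJ
  exact ⟨x, y, hJ.somePath, hx, hy, fun t => hJ.somePath_mem t⟩

/-! ### The crude event read on the lattice end -/

/-- **The crude event's probability under the lattice-end law**: by the `G_s` law
(`latMeasure.map gsConfig = sitePercolation _ half`, `gsConfig` measurable) and the measurability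
of `crudeCrossing R δ`, `latMeasure {θ | gsConfig θ ∈ crudeCrossing R δ} = siteCrossingProb R δ`
(`Measure.map_apply`). [folklore] -/
theorem latMeasure_real_gsConfig_mem_crudeCrossing
    (hgs : Measurable gsConfig ∧ latMeasure.map gsConfig = sitePercolation ((ℤ × ℤ) ⊕ (ℤ × ℤ)) half)
    (R : ConformalRectangle) {δ : ℝ} (hδ : 0 < δ) :
    latMeasure.real {θ : LatConfig | gsConfig θ ∈ crudeCrossing R δ} = siteCrossingProb R δ := by
  rw [siteCrossingProb, ← hgs.2, map_measureReal_apply hgs.1 (measurableSet_crudeCrossing R hδ)]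
  rfl

/-! ### The sandwich at a fixed mesh -/

/-- **The sandwich at a fixed small mesh `δ`.**  Let `R₁`, `R₂` be perturbed rectangles of `R`
with caps/collars data `F₀, F₂, r` (`r ∈ lowerMargins R R₁ F₀ F₂`, `r ∈ upperMargins R R₂`),
`0 < δ < r`, `2δ ≤ r`, `δ` below the separation of `(ab)` and `(cd)`.  Granted the dictionary, the
square-chain lemma, the `G_s` law and the local no-touch lemma,
`latProb R₁ δ ≤ siteCrossingProb R δ ≤ 1 − latProb R₂ δ`.
LOWER: on the good event a configuration in `latCrossing R₁ δ` carries a continuum path in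
`closure R₁ ∩ δ · latBlack θ` from `R₁.arc 0` to `R₁.arc 2` (`exists_path_of_mem_latCrossing`),
hence `gsConfig θ ∈ crudeCrossing R δ` (`mem_crudeCrossing_of_latBlack_path`); the bad event is
null (`latMeasure_bad`).  UPPER: the flipped event `latFlip ⁻¹' latCrossing R₂ δ` has probability
`latProb R₂ δ` (`latMeasure_real_preimage_latFlip`) and, on the good event, is a WHITE continuum
crossing of `R₂`, incompatible with the crude event (`false_of_crudeCrossing_of_whitePath`); split
it along the measurable crude event (`measureReal_inter_add_sdiff`, `probReal_compl_eq_one_sub`,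
`latMeasure_real_gsConfig_mem_crudeCrossing`). [cite: BollobasRiordan2006, Ch. 7 Lemma 14 with (19)] -/
theorem latSandwich_at
    (hdict : ∀ θ : LatConfig, θ.1.Nonempty → θ.1ᶜ.Nonempty → legBlackRegion (toLeg θ) = latBlack θ)
    (hchain : ∀ {δ : ℝ}, 0 < δ → ∀ (θ : LatConfig) {x y : ℂ} (γ : Path x y) (a b : ℝ),
      0 ≤ a → a ≤ b → b ≤ 1 → (∀ t ∈ Icc a b, γ.extend t / (δ : ℂ) ∈ latBlack θ) →
      ∃ u w : (ℤ × ℤ) ⊕ (ℤ × ℤ), dist (γ.extend a) ((δ : ℂ) * zGs u) ≤ 3 / 4 * δ ∧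
        dist (γ.extend b) ((δ : ℂ) * zGs w) ≤ 3 / 4 * δ ∧
        PathIn Gs ({v | ∃ t ∈ Icc a b, dist (γ.extend t) ((δ : ℂ) * zGs v) ≤ 3 / 4 * δ} ∩
          gsConfig θ) u w)
    (hgs : Measurable gsConfig ∧ latMeasure.map gsConfig = sitePercolation ((ℤ × ℤ) ⊕ (ℤ × ℤ)) half)
    (htouch : ∀ (θ : LatConfig) (u v : (ℤ × ℤ) ⊕ (ℤ × ℤ)), u ∈ gsConfig θ → v ∈ gsConfig θ →
      (u = v ∨ Gs.Adj u v) → ∀ z ∈ segment ℝ (zGs u) (zGs v), z ∉ latBlack (latFlip θ))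
    (R R₁ R₂ : ConformalRectangle) {F₀ F₂ : Set ℂ} {r δ : ℝ}
    (hlow : r ∈ lowerMargins R R₁ F₀ F₂) (hup : r ∈ upperMargins R R₂)
    (hδ : 0 < δ) (hδr : δ < r) (h2δr : 2 * δ ≤ r)
    (h02 : ∀ z : ℂ, infDist z (R.arc 0) ≤ δ → δ < infDist z (R.arc 2)) :
    latProb R₁ δ ≤ siteCrossingProb R δ ∧ siteCrossingProb R δ ≤ 1 - latProb R₂ δ := by
  haveI : IsProbabilityMeasure latMeasure := by
    unfold latMeasure
    infer_instance
  -- the events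
  set G : Set LatConfig := {θ | θ.1.Nonempty ∧ θ.1ᶜ.Nonempty}
  set C : Set LatConfig := {θ | gsConfig θ ∈ crudeCrossing R δ}
  have hCm : MeasurableSet C := hgs.1 (measurableSet_crudeCrossing R hδ)
  have hCsite : latMeasure.real C = siteCrossingProb R δ :=
    latMeasure_real_gsConfig_mem_crudeCrossing hgs R hδ
  have hbad : latMeasure.real Gᶜ = 0 := by
    rw [measureReal_eq_zero_iff]
    exact latMeasure_bad
  constructor
  · -- LOWER: `latCrossing R₁ δ ⊆ C ∪ Gᶜ`
    have hincl : latCrossing R₁ δ ⊆ C ∪ Gᶜ := by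
      intro θ hθ
      by_cases hθG : θ ∈ G
      · left
        obtain ⟨x, y, γ, hx, hy, hγ⟩ := exists_path_of_mem_latCrossing hdict hθ hθG.1 hθG.2
        exact mem_crudeCrossing_of_latBlack_path hchain R R₁ hδ θ hlow hδr h02 γ hx hy
          (fun t => (hγ t).1) (fun t => (hγ t).2)
      · exact Or.inr hθG
    have h1 : latProb R₁ δ ≤ latMeasure.real (C ∪ Gᶜ) := measureReal_mono hincl
    have h2 := measureReal_union_le (μ := latMeasure) C Gᶜ
    rw [← hCsite]
    linarith
  · -- UPPER: `W ∩ C ⊆ Gᶜ` for the flipped (white) crossing event `W` of `R₂`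
    obtain ⟨-, hcross⟩ := hup
    set W : Set LatConfig := latFlip ⁻¹' latCrossing R₂ δ
    have hwhite : latMeasure.real W = latProb R₂ δ := latMeasure_real_preimage_latFlip _
    have hexcl : W ∩ C ⊆ Gᶜ := by
      rintro θ ⟨hθW, hθC⟩ hθG
      have hθW' : latFlip θ ∈ latCrossing R₂ δ := hθW
      have h₁ : (latFlip θ).1.Nonempty := hθG.2
      have h₂ : (latFlip θ).1ᶜ.Nonempty := by
        show θ.1ᶜᶜ.Nonempty
        rw [compl_compl]
        exact hθG.1
      obtain ⟨p, q, P₀, hp, hq, hP₀⟩ :=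
        exists_path_of_mem_latCrossing hdict (θ := latFlip θ) hθW' h₁ h₂
      exact false_of_crudeCrossing_of_whitePath htouch R R₂ hδ θ hcross h2δr hθC P₀ hp hq
        (fun t => (hP₀ t).1) (fun t => (hP₀ t).2)
    have h1 : latMeasure.real (W ∩ C) + latMeasure.real (W \ C) = latMeasure.real W :=
      measureReal_inter_add_sdiff hCm
    have h2 : latMeasure.real (W ∩ C) ≤ latMeasure.real Gᶜ := measureReal_mono hexcl
    have h3 : latMeasure.real (W \ C) ≤ latMeasure.real Cᶜ := measureReal_mono fun θ hθ => hθ.2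
    have h4 : latMeasure.real Cᶜ = 1 - latMeasure.real C := probReal_compl_eq_one_sub hCm
    rw [← hCsite, ← hwhite]
    linarith

/-! ### The endpoint -/

/-- **THE LATTICE END** (the content of the registered stub `stub_latticeEnd_of`): given the
`t = 0` law reduction, the dictionary, the square-chain lemma, the `G_s` law and the local
no-touch lemma, Cardy's formula for the `t = 0` leg probabilities of every conformal rectangle
implies Cardy's formula for the crude site crossing of `G_s`.  A Poisson law of intensity `0`
exists (`exists_isPoissonPointProcess_zero`), so the hypothesis and the law reduction give
`latProb R' → F(η_{R'})` along `δ → 0⁺` for every `R'`; given `ε > 0`, K1's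
`stub_perturbedRectangles` at `θ = ε/4` gives `R₁`, `R₂`; eventually the sandwich
`latSandwich_at` holds (`δ < r/2`, `eventually_lt_infDist_arc_two`) and `latProb R₁ δ`,
`latProb R₂ δ` exceed `F(η₁) − ε/4`, `F(η₂) − ε/4`, where `|F(η₁) − F(η)| ≤ ε/4` and
`|(1 − F(η₂)) − F(η)| ≤ ε/4`: so `|siteCrossingProb R δ − F(η)| < ε` eventually.
[cite: BollobasRiordan2006, Ch. 7 Lemma 14 with (19)] -/
theorem latticeEnd
    (hlaw : ∀ (PB PW : Measure (PointConfig ℂ)),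
      IsPoissonPointProcess (0 : Measure ℂ) PB → IsPoissonPointProcess (0 : Measure ℂ) PW →
      ∀ (R : ConformalRectangle) (δ : ℝ), legProb 0 PB PW R δ = latProb R δ)
    (hdict : ∀ θ : LatConfig, θ.1.Nonempty → θ.1ᶜ.Nonempty → legBlackRegion (toLeg θ) = latBlack θ)
    (hchain : ∀ {δ : ℝ}, 0 < δ → ∀ (θ : LatConfig) {x y : ℂ} (γ : Path x y) (a b : ℝ),
      0 ≤ a → a ≤ b → b ≤ 1 → (∀ t ∈ Icc a b, γ.extend t / (δ : ℂ) ∈ latBlack θ) →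
      ∃ u w : (ℤ × ℤ) ⊕ (ℤ × ℤ), dist (γ.extend a) ((δ : ℂ) * zGs u) ≤ 3 / 4 * δ ∧
        dist (γ.extend b) ((δ : ℂ) * zGs w) ≤ 3 / 4 * δ ∧
        PathIn Gs ({v | ∃ t ∈ Icc a b, dist (γ.extend t) ((δ : ℂ) * zGs v) ≤ 3 / 4 * δ} ∩
          gsConfig θ) u w)
    (hgs : Measurable gsConfig ∧ latMeasure.map gsConfig = sitePercolation ((ℤ × ℤ) ⊕ (ℤ × ℤ)) half)
    (htouch : ∀ (θ : LatConfig) (u v : (ℤ × ℤ) ⊕ (ℤ × ℤ)), u ∈ gsConfig θ → v ∈ gsConfig θ →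
      (u = v ∨ Gs.Adj u v) → ∀ z ∈ segment ℝ (zGs u) (zGs v), z ∉ latBlack (latFlip θ))
    (hcardy : ∀ (PB PW : Measure (PointConfig ℂ)),
      IsPoissonPointProcess (0 : Measure ℂ) PB → IsPoissonPointProcess (0 : Measure ℂ) PW →
      ∀ R : ConformalRectangle, R.HasCrossingLimit (legProb 0 PB PW R) cardyFunction)
    (R : ConformalRectangle) : R.HasCrossingLimit (siteCrossingProb R) cardyFunction := by
  intro φ x hux
  -- the `t = 0` laws: the empty Poisson process; Cardy for `latProb` of every rectangle
  obtain ⟨P, hP⟩ := exists_isPoissonPointProcess_zero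
  have hlat : ∀ R' : ConformalRectangle, R'.HasCrossingLimit (latProb R') cardyFunction := by
    intro R' φ' x' h'
    have hfun : legProb 0 P P R' = latProb R' := funext fun δ => hlaw P P hP hP R' δ
    rw [← hfun]
    exact hcardy P P hP hP R' φ' x' h'
  rw [Metric.tendsto_nhds]
  intro ε hε
  have hθ : 0 < ε / 4 := by positivity
  obtain ⟨R₁, R₂, φ₁, x₁, φ₂, x₂, F₀, F₂, r, hx₁, hx₂, hCardy, hlow, hup⟩ :=
    stub_perturbedRectangles R (ε / 4) hθ
  obtain ⟨hc₁, hc₂⟩ := hCardy φ x hux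
  have hr0 : 0 < r := hlow.1
  -- the four eventualities
  have hev1 : ∀ᶠ δ in 𝓝[>] (0 : ℝ), δ < r ∧ 2 * δ ≤ r := by
    filter_upwards [Ioo_mem_nhdsGT (show (0 : ℝ) < r / 2 by positivity)] with δ hδ
    exact ⟨by linarith [hδ.2], by linarith [hδ.2]⟩
  have hev2 := eventually_lt_infDist_arc_two R
  have hev3 : ∀ᶠ δ in 𝓝[>] (0 : ℝ), cardyFunction (crossRatio x₁) - ε / 4 < latProb R₁ δ :=
    (hlat R₁ φ₁ x₁ hx₁).eventually (Ioi_mem_nhds (by linarith))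
  have hev4 : ∀ᶠ δ in 𝓝[>] (0 : ℝ), cardyFunction (crossRatio x₂) - ε / 4 < latProb R₂ δ :=
    (hlat R₂ φ₂ x₂ hx₂).eventually (Ioi_mem_nhds (by linarith))
  filter_upwards [hev1, hev2, hev3, hev4, self_mem_nhdsWithin] with δ hδ1 hδ2 hδ3 hδ4 hδ
  obtain ⟨hlo, hhi⟩ :=
    latSandwich_at hdict hchain hgs htouch R R₁ R₂ hlow hup hδ hδ1.1 hδ1.2 hδ2
  rw [Real.dist_eq, abs_lt]
  have ha₁ := abs_le.1 hc₁
  have ha₂ := abs_le.1 hc₂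
  constructor <;> linarith

/-! ### The registered stub -/

/-- **Stub (L, lead): the lattice end from its five pieces.**  Given the `t = 0` law reduction, the
dictionary, the square-chain lemma and the `G_s` law, Cardy for the `t = 0` leg probabilities of every
conformal rectangle gives Cardy for the crude site crossing of `G_s`: instantiate the Poisson pair at the
empty process (Kingman, intensity `0`), pass to `latProb` by the law reduction; at a fixed small mesh
sandwich `siteCrossingProb R δ` between `latProb R₁ δ` and `1 - latProb R₂ δ` for K1's perturbed
rectangles `R₁`, `R₂` (`stub_perturbedRectangles`: margins `lowerMargins` / `upperMargins`, Cardy values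
within `θ`) up to the null event "one colour missing" — lower inclusion by the chain lemma and K1 Parts
4/5/7 (first entry, collar exit), upper exclusion by the crossing clause and the local no-touch lemma
(fifth hypothesis), colour flip `latFlip` preserving `latMeasure` (`sitePercolation_map_compl`,
`symm_half`) and the `G_s` law identifying the crude event's probability; then squeeze as `δ → 0⁺` and
let `θ → 0` (the statement of `latticeEnd`). [cite: BollobasRiordan2006, Ch. 7 Lemma 14 with (19)] -/
theorem stub_latticeEnd_of : (∀ (PB PW : Measure (PointConfig ℂ)),
      IsPoissonPointProcess (0 : Measure ℂ) PB → IsPoissonPointProcess (0 : Measure ℂ) PW →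
      ∀ (R : ConformalRectangle) (δ : ℝ), legProb 0 PB PW R δ = latProb R δ) →
    (∀ θ : LatConfig, θ.1.Nonempty → θ.1ᶜ.Nonempty → legBlackRegion (toLeg θ) = latBlack θ) →
    (∀ {δ : ℝ}, 0 < δ → ∀ (θ : LatConfig) {x y : ℂ} (γ : Path x y) (a b : ℝ),
      0 ≤ a → a ≤ b → b ≤ 1 → (∀ t ∈ Icc a b, γ.extend t / (δ : ℂ) ∈ latBlack θ) →
      ∃ u w : (ℤ × ℤ) ⊕ (ℤ × ℤ), dist (γ.extend a) ((δ : ℂ) * zGs u) ≤ 3 / 4 * δ ∧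
        dist (γ.extend b) ((δ : ℂ) * zGs w) ≤ 3 / 4 * δ ∧
        Literature.Probability.Percolation.PathIn Gs
          ({v | ∃ t ∈ Icc a b, dist (γ.extend t) ((δ : ℂ) * zGs v) ≤ 3 / 4 * δ} ∩ gsConfig θ) u w) →
    (Measurable gsConfig ∧ latMeasure.map gsConfig = sitePercolation ((ℤ × ℤ) ⊕ (ℤ × ℤ)) half) →
    (∀ (θ : LatConfig) (u v : (ℤ × ℤ) ⊕ (ℤ × ℤ)), u ∈ gsConfig θ → v ∈ gsConfig θ →
      (u = v ∨ Gs.Adj u v) → ∀ z ∈ segment ℝ (zGs u) (zGs v), z ∉ latBlack (latFlip θ)) →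
    (∀ (PB PW : Measure (PointConfig ℂ)),
      IsPoissonPointProcess (0 : Measure ℂ) PB → IsPoissonPointProcess (0 : Measure ℂ) PW →
      ∀ R : ConformalRectangle, R.HasCrossingLimit (legProb 0 PB PW R) cardyFunction) →
    ∀ R : ConformalRectangle, R.HasCrossingLimit (siteCrossingProb R) cardyFunction := by
  intro hlaw hdict hchain hgs htouch hcardy R
  exact latticeEnd hlaw hdict hchain hgs htouch hcardy R

end Summit.CriticalPhenomena.CardyFormulaZ2.Cruxes.SquareFromVoronoiHub.PoissonDilutionLeg

end
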